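import Literature.AlgebraicGeometry.Resolution.RegularSystemOfParameters
import Summits.ResolutionOfSingularities.ResolutionOfSingularities.Theorems.WeightedInvariantIota3Sigma
import HarnessLib

/-!
# Two-flag tools: membership in `flagContactFiltration` by weight, and two-flags from a regular system of parameters

Topic: `Summits/ResolutionOfSingularities/ResolutionOfSingularities/Theorems`. Helper for the door item
`HypersurfaceCentreConstruction` (statement `stmt-ResolutionOfSingularities-19897`, route `WeightedInvariant`), line
`local-engine` of res-L1-w43-plan-1 (L W4.3), P3 rung, σ-side of IOTA3-DESIGN v1.2 (§2.3/§2.4): the two certificate steps every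
SPECIMEN row and every instance of res-type-061's `IsSigmaMaximiser` (`…P3bDrop`, p·) needs and that res-type-073's
`…Iota3Sigma` (p528355) leaves to its consumers —
(1) **membership by weight**: `g₁^α g₂^β c ∈ flagContactFiltration g₁ g₂ q r₁ r₂ n` as soon as `c ∈ 𝔪ᵏ` and
`r₁α + r₂β + qk ≥ n` (the ceiling `⌈(n − r₁α − r₂β)/q⌉ ≤ k`), with the pure-power / pure-transversal corollaries;
(2) **two-flags from a regular system of parameters**: two distinct members of a regular system of parameters of a regular local
ring form an `IsTwoFlag` (their residues are independent in `𝔪/𝔪²` — quasi-regularity in degree `1`, Matsumura 17.10, the tree's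
`coeff_mem_maximalIdeal_of_eval_mem_pow`), with the `𝔪 = (a, b, c)`, `dim = 3` packaging.

[OURS · L1 W4.3] Replaces the role of NO printed item; NOT a statement of the manuscript
[claim: Hironaka2017, status: under-review]. AI work, weaker than expert review. Def-free; nothing here asserts any clause of the
KEY.

## References
* H. Matsumura, *Commutative Ring Theory* (1986), Thm. 17.10 (quasi-regularity of a regular system of parameters), Thm. 14.2.
  [Matsumura1987]
* res-type-073 `…Iota3Sigma` (p528355), res-type-061 `…P3bDrop` (`IsSigmaMaximiser`), res-L1-w43-plan-1 IOTA3-DESIGN v1.2 (OURS).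
-/

noncomputable section

open IsLocalRing MvPolynomial Literature.AlgebraicGeometry.Resolution

set_option linter.dupNamespace false -- mandated namespace of this single-conjunct summit

namespace Summit.ResolutionOfSingularities.ResolutionOfSingularities.Cruxes.HypersurfaceCentreConstruction.LocalEngine

namespace Iota3

universe u

/-! ## §1 Membership in the two-flag filtration by weight -/

section Membership

variable {S : Type u} [CommRing S] [IsLocalRing S]

/-- The piece `(g₁^α g₂^β) · 𝔪^⌈(n − r₁α − r₂β)/q⌉` lies in level `n`. [folklore] -/
theorem flagPiece_le (g₁ g₂ : S) (q r₁ r₂ n α β : ℕ) :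
    Ideal.span {g₁ ^ α * g₂ ^ β} * maximalIdeal S ^ ((n - r₁ * α - r₂ * β + q - 1) / q) ≤
      flagContactFiltration g₁ g₂ q r₁ r₂ n := by
  rw [flagContactFiltration_def]
  exact le_iSup_of_le α (le_iSup_of_le β le_rfl)

/-- **Membership by weight**: if `c ∈ 𝔪ᵏ` and the weighted degree `r₁α + r₂β + qk` of `g₁^α g₂^β c` is at least `n`, then
`g₁^α g₂^β c ∈ flagContactFiltration g₁ g₂ q r₁ r₂ n` (`q > 0`). [folklore] -/
theorem mul_mem_flagContactFiltration_of_weight {g₁ g₂ c : S} {q r₁ r₂ n α β k : ℕ} (hq : 0 < q)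
    (hc : c ∈ maximalIdeal S ^ k) (hw : n ≤ r₁ * α + r₂ * β + q * k) :
    g₁ ^ α * g₂ ^ β * c ∈ flagContactFiltration g₁ g₂ q r₁ r₂ n := by
  refine flagPiece_le g₁ g₂ q r₁ r₂ n α β (Ideal.mul_mem_mul (Ideal.mem_span_singleton_self _) ?_)
  refine Ideal.pow_le_pow_right ?_ hc
  -- the ceiling `⌈(n − r₁α − r₂β)/q⌉ ≤ k` (the tree's `AQSHeightTwo.cdiv_le_of_le_mul` shape, inlined)
  rw [Nat.div_le_iff_le_mul_add_pred hq]
  have : n - r₁ * α - r₂ * β ≤ q * k := by omega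
  omega

/-- A pure transversal term: `c ∈ 𝔪ᵏ`, `qk ≥ n` ⇒ `c ∈ flagContactFiltration g₁ g₂ q r₁ r₂ n`. [folklore] -/
theorem mem_flagContactFiltration_of_mem_pow {g₁ g₂ c : S} {q r₁ r₂ n k : ℕ} (hq : 0 < q)
    (hc : c ∈ maximalIdeal S ^ k) (hw : n ≤ q * k) : c ∈ flagContactFiltration g₁ g₂ q r₁ r₂ n := by
  have h := mul_mem_flagContactFiltration_of_weight (g₁ := g₁) (g₂ := g₂) (r₁ := r₁) (r₂ := r₂) (α := 0) (β := 0) hq hc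
    (by simpa using hw)
  simpa using h

/-- A pure first-member power: `r₁α ≥ n` ⇒ `g₁^α ∈ flagContactFiltration g₁ g₂ q r₁ r₂ n`. [folklore] -/
theorem pow_left_mem_flagContactFiltration {g₁ g₂ : S} {q r₁ r₂ n α : ℕ} (hq : 0 < q) (hw : n ≤ r₁ * α) :
    g₁ ^ α ∈ flagContactFiltration g₁ g₂ q r₁ r₂ n := by
  have h := mul_mem_flagContactFiltration_of_weight (g₁ := g₁) (g₂ := g₂) (r₁ := r₁) (r₂ := r₂) (α := α) (β := 0)
    (k := 0) (c := 1) hq (by simp) (by simpa using hw)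
  simpa using h

/-- A pure second-member power: `r₂β ≥ n` ⇒ `g₂^β ∈ flagContactFiltration g₁ g₂ q r₁ r₂ n`. [folklore] -/
theorem pow_right_mem_flagContactFiltration {g₁ g₂ : S} {q r₁ r₂ n β : ℕ} (hq : 0 < q) (hw : n ≤ r₂ * β) :
    g₂ ^ β ∈ flagContactFiltration g₁ g₂ q r₁ r₂ n := by
  have h := mul_mem_flagContactFiltration_of_weight (g₁ := g₁) (g₂ := g₂) (r₁ := r₁) (r₂ := r₂) (α := 0) (β := β)
    (k := 0) (c := 1) hq (by simp) (by simpa using hw)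
  simpa using h

/-- The filtration absorbs units on the right (it is an ideal): `t ∈ level n ⇒ t * v ∈ level n`. [folklore] -/
theorem mul_unit_mem_flagContactFiltration {g₁ g₂ t : S} {q r₁ r₂ n : ℕ} (v : S)
    (ht : t ∈ flagContactFiltration g₁ g₂ q r₁ r₂ n) : t * v ∈ flagContactFiltration g₁ g₂ q r₁ r₂ n :=
  Ideal.mul_mem_right v _ ht

end Membership

/-! ## §2 Two-flags from a regular system of parameters -/

section TwoFlag

variable {T : Type u} [CommRing T] [IsRegularLocalRing T]

/-- **Two distinct members of a regular system of parameters form a two-flag**: if `(v₀, …, v_{d−1})` generates `𝔪` with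
`d = emb dim T` then for `i ≠ j` the residues of `vᵢ`, `vⱼ` are independent in `𝔪/𝔪²` — degree `1` of the quasi-regularity of a
regular system of parameters. [cite: Matsumura1987, Thm. 17.10] -/
theorem isTwoFlag_of_rsp {d : ℕ} (hd : (maximalIdeal T).spanFinrank = d) (v : Fin d → T)
    (hv : Ideal.span (Set.range v) = maximalIdeal T) {i j : Fin d} (hij : i ≠ j) : IsTwoFlag (v i) (v j) := by
  classical
  refine ⟨hv ▸ Ideal.subset_span ⟨i, rfl⟩, hv ▸ Ideal.subset_span ⟨j, rfl⟩, fun a b hab => ?_⟩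
  have hF : (C a * X i + C b * X j : MvPolynomial (Fin d) T).IsHomogeneous 1 :=
    ((isHomogeneous_C _ a).mul (isHomogeneous_X T i)).add ((isHomogeneous_C _ b).mul (isHomogeneous_X T j))
  have heval : eval v (C a * X i + C b * X j) ∈ maximalIdeal T ^ (1 + 1) := by
    simpa only [map_add, map_mul, eval_C, eval_X] using hab
  have hc := fun m => coeff_mem_maximalIdeal_of_eval_mem_pow hd v hv hF heval m
  have ha := hc (Finsupp.single i 1)
  have hb := hc (Finsupp.single j 1)
  simp only [coeff_add, coeff_C_mul, coeff_X, Finsupp.single_eq_single_iff, hij, hij.symm, and_true, one_ne_zero,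
    and_self, or_false, if_true, if_false, mul_one, mul_zero, add_zero, zero_add] at ha hb
  exact ⟨ha, hb⟩

/-- `Set.range ![a, b, c] = {a, b, c}`. [folklore] -/
theorem range_vec₃ {R : Type u} (a b c : R) : Set.range ![a, b, c] = {a, b, c} := by
  ext t
  simp only [Set.mem_range, Set.mem_insert_iff, Set.mem_singleton_iff]
  constructor
  · rintro ⟨i, hi⟩
    fin_cases i
    · exact Or.inl hi.symm
    · exact Or.inr (Or.inl hi.symm)
    · exact Or.inr (Or.inr hi.symm)
  · rintro (h | h | h)
    · exact ⟨0, h.symm⟩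
    · exact ⟨1, h.symm⟩
    · exact ⟨2, h.symm⟩

/-- In a regular local ring of dimension `3`, `emb dim = 3`. [folklore] -/
theorem spanFinrank_eq_three_of_ringKrullDim (hdim : ringKrullDim T = 3) : (maximalIdeal T).spanFinrank = 3 := by
  have h := IsRegularLocalRing.spanFinrank_maximalIdeal (R := T)
  rw [hdim] at h
  exact_mod_cast h

/-- **The flags of a named regular system `𝔪 = (a, b, c)` in dimension `3`**: `(a, b)`, `(a, c)` and `(b, c)` are two-flags
(and so are the swapped pairs, by the same lemma applied to a permuted system). [cite: Matsumura1987, Thm. 17.10] -/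
theorem isTwoFlag_of_span_triple_eq (hdim : ringKrullDim T = 3) {a b c : T}
    (h : Ideal.span {a, b, c} = maximalIdeal T) : IsTwoFlag a b ∧ IsTwoFlag a c ∧ IsTwoFlag b c := by
  have hd := spanFinrank_eq_three_of_ringKrullDim hdim
  have hv : Ideal.span (Set.range ![a, b, c]) = maximalIdeal T := by rw [range_vec₃, h]
  refine ⟨?_, ?_, ?_⟩
  · exact isTwoFlag_of_rsp hd ![a, b, c] hv (i := 0) (j := 1) (by decide)
  · exact isTwoFlag_of_rsp hd ![a, b, c] hv (i := 0) (j := 2) (by decide)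
  · exact isTwoFlag_of_rsp hd ![a, b, c] hv (i := 1) (j := 2) (by decide)

/-- A two-flag is symmetric. [folklore] -/
theorem IsTwoFlag.symm {S : Type u} [CommRing S] [IsLocalRing S] {g₁ g₂ : S} (h : IsTwoFlag g₁ g₂) :
    IsTwoFlag g₂ g₁ :=
  ⟨h.2.1, h.1, fun a b hab => (h.2.2 b a (by rwa [add_comm])).symm⟩

end TwoFlag

end Iota3

end Summit.ResolutionOfSingularities.ResolutionOfSingularities.Cruxes.HypersurfaceCentreConstruction.LocalEngine

end
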